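import Summits.NavierStokesRegularity.NavierStokesRegularity.Theorems.AdaptedFrequencyTangentFlowTransferKernelCalculus
import Summits.NavierStokesRegularity.NavierStokesRegularity.Theorems.AdaptedFrequencyAdaptedKernelExistsKernelLimitSlices
import Summits.NavierStokesRegularity.NavierStokesRegularity.Theorems.AdaptedFrequencyAdaptedKernelExistsWeakCorrectorCalculus
import Mathlib.MeasureTheory.Integral.Prod
import HarnessLib

/-!
# Adapted kernels are very weak solutions; very weak limits
# (route `AdaptedFrequency`, item `TangentFlowTransfer`, stmt-NavierStokesRegularity-10494)

Helper file (all results proved). Second step of the proof of hypothesis (B) (kernel stability)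
of `tangentFlowTransfer_of_hyp`, preparing the hypoelliptic smoothing of the pointwise limit of
the kernels (`stub_hypoelliptic` of the `AdaptedKernelExists` line):

* `veryWeak_of_isAdaptedBackwardKernel`: an adapted backward kernel `G` of `∂ₜ + b·∇ − νΔ` on a
  window `[a, T)` (jointly smooth divergence-free drift) satisfies the very weak identity
  `∫∫ G (∂ₜΦ + DₓΦ·b − νΔₓΦ) = 0` for every smooth `Φ` compactly supported in `(a, T) × ℝ³`
  (differentiate `t ↦ ∫ Φ(t)G(t)` with the landed kernel calculus, integrate in time, Fubini);
* `veryWeak_limit`: the identity passes to pointwise limits `g_k → K`, `w_k → W` under a uniform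
  sup bound for the kernels and a uniform drift bound on the support (dominated convergence).
-/

noncomputable section

open MeasureTheory Set Function Filter TopologicalSpace Metric
open scoped Topology ContDiff Laplacian

namespace Summit.NavierStokesRegularity.NavierStokesRegularity.Theorems

open Literature.Analysis Literature.Analysis.FluidPDE
open Summit.NavierStokesRegularity.NavierStokesRegularity.Theorems.AdaptedKernelExists.NashEntropyLastBlock

local notation "ℝ³" => EuclideanSpace ℝ (Fin 3)

/-! ### The very weak operator applied to a test function -/

/-- Time bounds of a compact support inside an open time window `(a, T) × ℝ³`. [folklore] -/
theorem time_bounds_of_tsupport_subset {Φ : ℝ × ℝ³ → ℝ} (hΦc : HasCompactSupport Φ) {a T : ℝ}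
    (hΦs : tsupport Φ ⊆ Ioo a T ×ˢ univ) (hne : (tsupport Φ).Nonempty) :
    ∃ t₁ t₂ : ℝ, a < t₁ ∧ t₁ ≤ t₂ ∧ t₂ < T ∧ ∀ p ∈ tsupport Φ, p.1 ∈ Icc t₁ t₂ := by
  set K : Set ℝ := Prod.fst '' tsupport Φ with hK
  have hKc : IsCompact K := hΦc.isCompact.image continuous_fst
  have hKne : K.Nonempty := hne.image _
  have hKsub : K ⊆ Ioo a T := by
    rintro _ ⟨p, hp, rfl⟩
    exact (hΦs hp).1
  obtain ⟨k, hk⟩ := hKne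
  refine ⟨sInf K, sSup K, (hKsub (hKc.sInf_mem ⟨k, hk⟩)).1,
    (csInf_le hKc.bddBelow hk).trans (le_csSup hKc.bddAbove hk), (hKsub (hKc.sSup_mem ⟨k, hk⟩)).2,
    fun p hp => ⟨csInf_le hKc.bddBelow ⟨p, hp, rfl⟩, le_csSup hKc.bddAbove ⟨p, hp, rfl⟩⟩⟩

/-- The very weak integrand `LΦ = ∂ₜΦ + DₓΦ·b − νΔₓΦ` vanishes off `tsupport Φ`. [folklore] -/
theorem opSlice_eq_zero_of_notMem_tsupport {Φ : ℝ × ℝ³ → ℝ} {b : ℝ → ℝ³ → ℝ³} {ν : ℝ}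
    {p : ℝ × ℝ³} (hp : p ∉ tsupport Φ) :
    deriv (fun s => Φ (s, p.2)) p.1 + fderiv ℝ (fun y => Φ (p.1, y)) p.2 (b p.1 p.2) -
      ν * (Δ (fun y => Φ (p.1, y))) p.2 = 0 := by
  obtain ⟨h1, h2, h3⟩ := kernelLimit_sliceDerivs_eq_zero hp (b p.1 p.2)
  rw [h1, h2, h3]; ring

/-- The very weak integrand is continuous on `ℝ × ℝ³` as soon as the drift is jointly continuous
on an open time window containing the support of `Φ`. [folklore] -/
theorem continuous_opSlice {Φ : ℝ × ℝ³ → ℝ} (hΦ : ContDiff ℝ ∞ Φ) {S : Set ℝ} (hS : IsOpen S)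
    (hΦs : tsupport Φ ⊆ S ×ˢ univ) {b : ℝ → ℝ³ → ℝ³} (hb : ContinuousOn (uncurry b) (S ×ˢ univ))
    (ν : ℝ) :
    Continuous fun p : ℝ × ℝ³ => deriv (fun s => Φ (s, p.2)) p.1 +
      fderiv ℝ (fun y => Φ (p.1, y)) p.2 (b p.1 p.2) - ν * (Δ (fun y => Φ (p.1, y))) p.2 := by
  have hΦ1 : ContDiff ℝ 1 Φ := hΦ.of_le (by norm_cast)
  have hO : IsOpen (S ×ˢ (univ : Set ℝ³)) := hS.prod isOpen_univ
  refine kernelLimit_continuous_of_tsupport_subset hO ?_ ?_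
  · have h1 : Continuous fun p : ℝ × ℝ³ => deriv (fun s => Φ (s, p.2)) p.1 :=
      kernelLimit_continuous_deriv_slice hΦ
    have h3 : Continuous fun p : ℝ × ℝ³ => (Δ (fun y => Φ (p.1, y))) p.2 :=
      kernelLimit_continuous_laplacian_slice hΦ
    have h2 : ContinuousOn (fun p : ℝ × ℝ³ => fderiv ℝ (fun y => Φ (p.1, y)) p.2 (b p.1 p.2))
        (S ×ˢ univ) := by
      have e : (fun p : ℝ × ℝ³ => fderiv ℝ (fun y => Φ (p.1, y)) p.2 (b p.1 p.2)) =
          fun p => fderiv ℝ Φ p (0, b p.1 p.2) :=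
        funext fun p => kernelLimit_fderiv_slice_eq hΦ1 p _
      rw [e]
      refine (hΦ1.continuous_fderiv one_ne_zero).continuousOn.clm_apply ?_
      exact (continuousOn_const.prodMk hb)
    exact (h1.continuousOn.add h2).sub (continuousOn_const.mul h3.continuousOn)
  · refine (closure_minimal (fun p hp => ?_) (isClosed_tsupport Φ)).trans hΦs
    by_contra hp'
    exact hp (opSlice_eq_zero_of_notMem_tsupport hp')

/-! ### Adapted kernels are very weak solutions -/

/-- **An adapted backward kernel is a very weak solution.** For an adapted kernel `G` of
`∂ₜ + b·∇ − νΔ` on `[a, T)` with jointly smooth divergence-free drift `b`, and every smooth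
`Φ` compactly supported in `(a, T) × ℝ³`: `∫∫ G (∂ₜΦ + DₓΦ·b − νΔₓΦ) = 0`. Proof: with
`F(t) = ∫ Φ(t)G(t)`, the kernel calculus gives `F′(t) = ∫ (LΦ)(t) G(t)`
(`hasDerivAt_integral_mul_of_isAdaptedBackwardKernel`); `F` vanishes outside the time
projection of the support, so `∫ F′ = 0`, and `∫∫ G·LΦ = ∫ F′` by Fubini. [folklore] -/
theorem veryWeak_of_isAdaptedBackwardKernel {ν a T : ℝ} {b : ℝ → ℝ³ → ℝ³} {x₀ : ℝ³}
    {G : ℝ → ℝ³ → ℝ} (hb : IsSmoothSpaceTimeOn (Ico a T) b)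
    (hdiv : ∀ t ∈ Ico a T, VectorCalculus.IsDivFree (b t))
    (hG : IsAdaptedBackwardKernel ν b (Ico a T) T x₀ G) {Φ : ℝ × ℝ³ → ℝ} (hΦ : ContDiff ℝ ∞ Φ)
    (hΦc : HasCompactSupport Φ) (hΦs : tsupport Φ ⊆ Ioo a T ×ˢ univ) :
    ∫ p : ℝ × ℝ³, G p.1 p.2 * (deriv (fun s => Φ (s, p.2)) p.1 +
        fderiv ℝ (fun y => Φ (p.1, y)) p.2 (b p.1 p.2) - ν * (Δ (fun y => Φ (p.1, y))) p.2) = 0 := by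
  -- the trivial case of an empty support
  rcases (tsupport Φ).eq_empty_or_nonempty with hempty | hne
  · refine integral_eq_zero_of_ae (Eventually.of_forall fun p => ?_)
    have hp : p ∉ tsupport Φ := by rw [hempty]; exact fun h => h
    change G p.1 p.2 * _ = 0
    rw [opSlice_eq_zero_of_notMem_tsupport hp, mul_zero]
  -- notation
  set S : Set ℝ := Ioo a T with hSdef
  have hSo : IsOpen S := isOpen_Ioo
  have hSI : S ⊆ Ico a T := Ioo_subset_Ico_self
  have hO : IsOpen (S ×ˢ (univ : Set ℝ³)) := hSo.prod isOpen_univ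
  set L : ℝ × ℝ³ → ℝ := fun p => deriv (fun s => Φ (s, p.2)) p.1 +
    fderiv ℝ (fun y => Φ (p.1, y)) p.2 (b p.1 p.2) - ν * (Δ (fun y => Φ (p.1, y))) p.2 with hL
  have hL0 : ∀ p, p ∉ tsupport Φ → L p = 0 := fun p hp => opSlice_eq_zero_of_notMem_tsupport hp
  have hLc : Continuous L :=
    continuous_opSlice hΦ hSo hΦs (hb.continuousOn.mono (prod_mono hSI Subset.rfl)) ν
  have hGc : ContinuousOn (fun p : ℝ × ℝ³ => G p.1 p.2) (S ×ˢ univ) :=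
    hG.contDiffOn.continuousOn.mono (prod_mono hSI Subset.rfl)
  -- integrability of `G · LΦ` on space-time
  have hfi : Integrable (fun p : ℝ × ℝ³ => G p.1 p.2 * L p) :=
    weakCorrector_integrable_mul_of_tsupport hO hGc hLc hΦc hΦs hL0
  -- time bounds of the support
  obtain ⟨t₁, t₂, hat₁, h12, ht₂T, htime⟩ := time_bounds_of_tsupport_subset hΦc hΦs hne
  have hoff : ∀ s, s ∉ Icc t₁ t₂ → ∀ x, ((s, x) : ℝ × ℝ³) ∉ tsupport Φ :=
    fun s hs x h => hs (htime _ h)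
  -- the pairing and its derivative
  set F : ℝ → ℝ := fun s => ∫ x, Φ (s, x) * G s x with hF
  set F' : ℝ → ℝ := fun s => ∫ x, G s x * L (s, x) with hF'
  have hderiv : ∀ s ∈ S, HasDerivAt F (F' s) s := by
    intro s hs
    have hq : ContDiffOn ℝ 2 (uncurry fun r (y : ℝ³) => Φ (r, y)) (S ×ˢ univ) :=
      (contDiff_infty.1 hΦ 2).contDiffOn
    have hKx : IsCompact (Prod.snd '' tsupport Φ) := hΦc.isCompact.image continuous_snd
    have hsupp : ∀ r ∈ S, ∀ x ∉ Prod.snd '' tsupport Φ, Φ (r, x) = 0 := by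
      intro r _ x hx
      by_contra h
      exact hx ⟨(r, x), subset_tsupport _ h, rfl⟩
    have h := hasDerivAt_integral_mul_of_isAdaptedBackwardKernel (hG.mono hSI (uniqueDiffOn_Ioo a T))
      hSo (fun r hr => (hb.contDiff_slice (hSI hr)).of_le (by exact_mod_cast le_top))
      (fun r hr x => hdiv r (hSI hr) x) hq hKx hsupp hs
    refine h.congr_deriv (integral_congr_ae (Eventually.of_forall fun x => ?_))
    simp only [hL]
    ring
  have hF0 : ∀ s, s ∉ Icc t₁ t₂ → F s = 0 := by
    intro s hs
    refine integral_eq_zero_of_ae (Eventually.of_forall fun x => ?_)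
    simp only [image_eq_zero_of_notMem_tsupport (hoff s hs x), zero_mul, Pi.zero_apply]
  have hF'0 : ∀ s, s ∉ Icc t₁ t₂ → F' s = 0 := by
    intro s hs
    refine integral_eq_zero_of_ae (Eventually.of_forall fun x => ?_)
    simp only [hL0 _ (hoff s hs x), mul_zero, Pi.zero_apply]
  -- Fubini: `∫∫ G·LΦ = ∫ F'`
  have hfub : ∫ p, G p.1 p.2 * L p = ∫ s, F' s := by
    have := integral_prod (μ := (volume : Measure ℝ)) (ν := (volume : Measure ℝ³))
      (fun p : ℝ × ℝ³ => G p.1 p.2 * L p) hfi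
    exact this
  -- `∫ F' = F(t₂') - F(t₁') = 0`
  set t₁' : ℝ := (a + t₁) / 2 with ht₁'
  set t₂' : ℝ := (t₂ + T) / 2 with ht₂'
  have h1 : t₁' < t₁ := by rw [ht₁']; linarith
  have h2 : t₂ < t₂' := by rw [ht₂']; linarith
  have hsub : uIcc t₁' t₂' ⊆ S := by
    rw [uIcc_of_le (by linarith)]
    exact fun r hr => ⟨by rw [ht₁'] at hr; linarith [hr.1], by rw [ht₂'] at hr; linarith [hr.2]⟩
  have hsuppF' : support F' ⊆ Ioc t₁' t₂' := by
    intro s hs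
    by_contra hs'
    refine hs (hF'0 s fun hsI => hs' ⟨?_, ?_⟩)
    · linarith [hsI.1]
    · linarith [hsI.2]
  have hint : IntervalIntegrable F' volume t₁' t₂' := (hfi.integral_prod_left).intervalIntegrable
  have hFTC : ∫ s in t₁'..t₂', F' s = F t₂' - F t₁' :=
    intervalIntegral.integral_eq_sub_of_hasDerivAt (fun s hs => hderiv s (hsub hs)) hint
  have hI : ∫ s, F' s = 0 := by
    rw [← intervalIntegral.integral_eq_integral_of_support_subset hsuppF', hFTC,
      hF0 t₂' (fun h => by linarith [h.2]), hF0 t₁' (fun h => by linarith [h.1]), sub_zero]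
  exact hfub.trans hI

/-! ### Very weak limits -/

/-- **Very weak identities pass to pointwise limits.** Let `g_k → K` and `w_k → W` pointwise on
the support of a test function `Φ` (compactly supported in an open slab `S × ℝ³`), with
`|g_k| ≤ M` and `‖w_k‖ ≤ Bd` there, the `g_k` continuous and the `w_k` jointly continuous on
`S × ℝ³`. If every `g_k` satisfies the very weak identity with drift `w_k`, then `K` satisfies it
with drift `W` (dominated convergence on `tsupport Φ`). [folklore] -/
theorem veryWeak_limit {S : Set ℝ} (hS : IsOpen S) {ν : ℝ} {w : ℕ → ℝ → ℝ³ → ℝ³} {W : ℝ → ℝ³ → ℝ³}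
    {g : ℕ → ℝ → ℝ³ → ℝ} {K : ℝ → ℝ³ → ℝ} {Φ : ℝ × ℝ³ → ℝ} (hΦ : ContDiff ℝ ∞ Φ)
    (hΦc : HasCompactSupport Φ) (hΦs : tsupport Φ ⊆ S ×ˢ univ)
    (hwc : ∀ k, ContinuousOn (uncurry (w k)) (S ×ˢ univ))
    (hgc : ∀ k, ContinuousOn (uncurry (g k)) (S ×ˢ univ)) {M Bd : ℝ}
    (hgM : ∀ k, ∀ p ∈ tsupport Φ, |g k p.1 p.2| ≤ M)
    (hwB : ∀ k, ∀ p ∈ tsupport Φ, ‖w k p.1 p.2‖ ≤ Bd)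
    (hgK : ∀ p ∈ tsupport Φ, Tendsto (fun k => g k p.1 p.2) atTop (𝓝 (K p.1 p.2)))
    (hwW : ∀ p ∈ tsupport Φ, Tendsto (fun k => w k p.1 p.2) atTop (𝓝 (W p.1 p.2)))
    (hvw : ∀ k, ∫ p : ℝ × ℝ³, g k p.1 p.2 * (deriv (fun s => Φ (s, p.2)) p.1 +
        fderiv ℝ (fun y => Φ (p.1, y)) p.2 (w k p.1 p.2) - ν * (Δ (fun y => Φ (p.1, y))) p.2) = 0) :
    ∫ p : ℝ × ℝ³, K p.1 p.2 * (deriv (fun s => Φ (s, p.2)) p.1 +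
        fderiv ℝ (fun y => Φ (p.1, y)) p.2 (W p.1 p.2) - ν * (Δ (fun y => Φ (p.1, y))) p.2) = 0 := by
  have hΦ1 : ContDiff ℝ 1 Φ := hΦ.of_le (by norm_cast)
  have hO : IsOpen (S ×ˢ (univ : Set ℝ³)) := hS.prod isOpen_univ
  -- bounds for the slice derivatives of `Φ`
  obtain ⟨M₀, hM₀⟩ := (hΦc.fderiv (𝕜 := ℝ)).exists_bound_of_continuous
    (hΦ1.continuous_fderiv one_ne_zero)
  have hdc : Continuous fun p : ℝ × ℝ³ => deriv (fun s => Φ (s, p.2)) p.1 :=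
    kernelLimit_continuous_deriv_slice hΦ
  have hlc : Continuous fun p : ℝ × ℝ³ => (Δ (fun y => Φ (p.1, y))) p.2 :=
    kernelLimit_continuous_laplacian_slice hΦ
  obtain ⟨M₁, hM₁⟩ := (hΦc.mono' (f' := fun p : ℝ × ℝ³ => deriv (fun s => Φ (s, p.2)) p.1)
    (fun p hp => by
      by_contra h
      exact hp (by simpa using (kernelLimit_sliceDerivs_eq_zero h (0 : ℝ³)).1))).exists_bound_of_continuous hdc
  obtain ⟨M₂, hM₂⟩ := (hΦc.mono' (f' := fun p : ℝ × ℝ³ => (Δ (fun y => Φ (p.1, y))) p.2)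
    (fun p hp => by
      by_contra h
      exact hp (by simpa using (kernelLimit_sliceDerivs_eq_zero h (0 : ℝ³)).2.2))).exists_bound_of_continuous hlc
  -- the dominating function
  set bound : ℝ × ℝ³ → ℝ := (tsupport Φ).indicator fun _ => |M| * (M₁ + M₀ * Bd + |ν| * M₂)
    with hbound
  have hbi : Integrable bound := by
    rw [hbound]
    exact (integrableOn_const (hs := hΦc.isCompact.measure_lt_top.ne)
      (C := |M| * (M₁ + M₀ * Bd + |ν| * M₂))).integrable_indicator (isClosed_tsupport Φ).measurableSet
  -- the integrands
  set F : ℕ → ℝ × ℝ³ → ℝ := fun k p => g k p.1 p.2 * (deriv (fun s => Φ (s, p.2)) p.1 +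
    fderiv ℝ (fun y => Φ (p.1, y)) p.2 (w k p.1 p.2) - ν * (Δ (fun y => Φ (p.1, y))) p.2) with hFdef
  set f : ℝ × ℝ³ → ℝ := fun p => K p.1 p.2 * (deriv (fun s => Φ (s, p.2)) p.1 +
    fderiv ℝ (fun y => Φ (p.1, y)) p.2 (W p.1 p.2) - ν * (Δ (fun y => Φ (p.1, y))) p.2) with hfdef
  have hlim : Tendsto (fun k => ∫ p, F k p) atTop (𝓝 (∫ p, f p)) := by
    refine tendsto_integral_of_dominated_convergence bound (fun k => ?_) hbi (fun k => ?_) ?_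
    · -- measurability: `F k` is continuous
      have hLc := continuous_opSlice hΦ hS hΦs (hwc k) ν
      exact (weakCorrector_continuous_mul_of_tsupport hO (hgc k) hLc
        ((closure_minimal (fun p hp => by
          by_contra hp'
          exact hp (opSlice_eq_zero_of_notMem_tsupport hp')) (isClosed_tsupport Φ)).trans hΦs)).aestronglyMeasurable
    · refine Eventually.of_forall fun p => ?_
      by_cases hp : p ∈ tsupport Φ
      · rw [hbound, indicator_of_mem hp, Real.norm_eq_abs, hFdef]
        simp only
        rw [abs_mul]
        have hM' : |g k p.1 p.2| ≤ |M| := (hgM k p hp).trans (le_abs_self M)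
        have hB0 : 0 ≤ Bd := (norm_nonneg _).trans (hwB k p hp)
        have h1 : |deriv (fun s => Φ (s, p.2)) p.1| ≤ M₁ := by
          rw [← Real.norm_eq_abs]; exact hM₁ p
        have h2 : |fderiv ℝ (fun y => Φ (p.1, y)) p.2 (w k p.1 p.2)| ≤ M₀ * Bd := by
          rw [kernelLimit_fderiv_slice_eq hΦ1 p, ← Real.norm_eq_abs]
          refine (ContinuousLinearMap.le_opNorm _ _).trans ?_
          have hn : ‖((0 : ℝ), w k p.1 p.2)‖ ≤ Bd := by
            rw [Prod.norm_def]; simp [hwB k p hp]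
          exact mul_le_mul (hM₀ p) hn (norm_nonneg _) ((norm_nonneg _).trans (hM₀ p))
        have h3 : |ν * (Δ (fun y => Φ (p.1, y))) p.2| ≤ |ν| * M₂ := by
          rw [abs_mul]
          exact mul_le_mul_of_nonneg_left (by rw [← Real.norm_eq_abs]; exact hM₂ p) (abs_nonneg ν)
        have hsum : |deriv (fun s => Φ (s, p.2)) p.1 + fderiv ℝ (fun y => Φ (p.1, y)) p.2 (w k p.1 p.2) -
            ν * (Δ (fun y => Φ (p.1, y))) p.2| ≤ M₁ + M₀ * Bd + |ν| * M₂ := by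
          refine (abs_sub _ _).trans ?_
          refine (add_le_add (abs_add_le _ _) le_rfl).trans ?_
          linarith
        exact mul_le_mul hM' hsum (abs_nonneg _) (abs_nonneg M)
      · have h0 : F k p = 0 := by
          rw [hFdef]; simp only [opSlice_eq_zero_of_notMem_tsupport hp, mul_zero]
        rw [h0, norm_zero, hbound, indicator_of_notMem hp]
    · refine Eventually.of_forall fun p => ?_
      by_cases hp : p ∈ tsupport Φ
      · have hD : Tendsto (fun k => fderiv ℝ (fun y => Φ (p.1, y)) p.2 (w k p.1 p.2)) atTop
            (𝓝 (fderiv ℝ (fun y => Φ (p.1, y)) p.2 (W p.1 p.2))) :=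
          ((fderiv ℝ (fun y => Φ (p.1, y)) p.2).continuous.tendsto _).comp (hwW p hp)
        exact (hgK p hp).mul ((tendsto_const_nhds.add hD).sub tendsto_const_nhds)
      · have h0 : ∀ k, F k p = 0 := fun k => by
          rw [hFdef]; simp only [opSlice_eq_zero_of_notMem_tsupport hp, mul_zero]
        have h1 : f p = 0 := by
          rw [hfdef]; simp only [opSlice_eq_zero_of_notMem_tsupport hp, mul_zero]
        simp only [h0, h1]
        exact tendsto_const_nhds
  have hzero : Tendsto (fun k => ∫ p, F k p) atTop (𝓝 0) := by
    have e : (fun k => ∫ p, F k p) = fun _ => 0 := funext fun k => hvw k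
    rw [e]; exact tendsto_const_nhds
  exact tendsto_nhds_unique hlim hzero

end Summit.NavierStokesRegularity.NavierStokesRegularity.Theorems

end
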